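import Mathlib
import Summits.Ventures.PercRepro2.Defs
import Summits.Ventures.PercRepro2.Graph
import Summits.Ventures.PercRepro2.HullDefs
import Summits.Ventures.PercRepro2.HullFlip
import Summits.Ventures.PercRepro2.HullTheoremA
import Summits.Ventures.PercRepro2.HullDownSet
import Summits.Ventures.PercRepro2.AvoidSameSide
import Summits.Ventures.PercRepro2.AvoidSameSideCore

/-!
# The down-set (Hall) rows for the SAME-SIDE kernel: (DOWN), (DHK), (CDOWN), (CS)
(blind cell PercRepro2, mine-1 g9; MINE-1.md §25.1–25.2)

With the same-side kernel `s_{x,l}(ζ) · s_{y,l}(ζ)` (`Hull.sideSign`), the rows are counting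
statements over down-sets — Hall's condition for an injection `{x, y on opposite sides} →
{x, y on the same side}` that only moves the hull (resp. the pair (hull, core), resp. the core)
downwards:

* **`SameDownRow`** (row (DOWN)): `Σ_{ζ : H_l(ζ) ∈ 𝒟} s_x s_y ≥ 0` for every down-set `𝒟` of vertex sets;
* **`SameDHKRow`** ((DHK)): the same for every down-set of pairs `(H_l, core)` (product order);
* **`SameCoreDownRow`** ((CDOWN)): the same for every down-set of cores;
* **`SameCSRow`** ((CS), core-size partial sums): `Σ_{ζ : |core| ≤ j} s_x s_y ≥ 0` for every `j`;
* implications `sameDownRow_of_sameDHKRow`, `sameCoreDownRow_of_sameDHKRow`,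
  `sameCSRow_of_sameCoreDownRow`;
* **`avoidSameSideNonneg_of_sameDownRow`**: (DOWN) implies the statement of record
  `AvoidSameSideNonneg` (`A(T;T) ≥ 0` for every `T`, `AvoidSameSide.lean`) — the principal down-set
  `{H : T ∩ H = ∅}`;
* **`sameCS_one`**: the `j = 1` layer of (CS) is the core-trivial theorem
  (`sum_sideSign_sideSign_nonneg_core`, `AvoidSameSideCore.lean`).

Census (mine-1 g9, exact, every down-set): (DOWN) and (CDOWN) `n = 7, m ≤ 11`: 0 / 8,557,080 each;
(DHK) unions of two principal down-sets `n = 7, m ≤ 10`: 0 / 119,070,000. Single hulls / single cores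
are NOT nonnegative (NEG-49). Statements, implications and the `j = 1` theorem only.
-/

namespace Summit.Ventures.PercRepro2

namespace Hull

open scoped Classical

variable {V : Type*} {E : Type*} [Fintype E] [DecidableEq E]

/-! ## The rows -/

/-- **Row (DOWN)**: for every down-set `𝒟` of vertex sets, `Σ_{ζ : H_l(ζ) ∈ 𝒟} s_{x,l} s_{y,l} ≥ 0`. -/
def SameDownRow (R : Type*) [Ring R] [LinearOrder R] (ends : E → Sym2 V) (l x y : V) : Prop :=
  ∀ 𝒟 : Set (Set V), IsLowerSet 𝒟 →
    0 ≤ ∑ ζ : Config E, if hull ends ζ l ∈ 𝒟 then sideSign R ends ζ l x * sideSign R ends ζ l y else 0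

/-- **Row (DHK)**: for every down-set `𝒟` of pairs `(H, K)` (product order),
`Σ_{ζ : (H_l, core) ∈ 𝒟} s_{x,l} s_{y,l} ≥ 0`. -/
def SameDHKRow (R : Type*) [Ring R] [LinearOrder R] (ends : E → Sym2 V) (l x y : V) : Prop :=
  ∀ 𝒟 : Set (Set V × Set V), IsLowerSet 𝒟 →
    0 ≤ ∑ ζ : Config E, if (hull ends ζ l, core ends ζ l) ∈ 𝒟 then
      sideSign R ends ζ l x * sideSign R ends ζ l y else 0

/-- **Row (CDOWN)**: for every down-set `𝒟` of vertex sets, `Σ_{ζ : core(ζ) ∈ 𝒟} s_{x,l} s_{y,l} ≥ 0`. -/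
def SameCoreDownRow (R : Type*) [Ring R] [LinearOrder R] (ends : E → Sym2 V) (l x y : V) : Prop :=
  ∀ 𝒟 : Set (Set V), IsLowerSet 𝒟 →
    0 ≤ ∑ ζ : Config E, if core ends ζ l ∈ 𝒟 then sideSign R ends ζ l x * sideSign R ends ζ l y else 0

/-- **Row (CS)** (core-size partial sums): for every `j`, `Σ_{ζ : |core(ζ)| ≤ j} s_{x,l} s_{y,l} ≥ 0`. -/
def SameCSRow (R : Type*) [Ring R] [LinearOrder R] (ends : E → Sym2 V) (l x y : V) : Prop :=
  ∀ j : ℕ, 0 ≤ ∑ ζ : Config E, if (core ends ζ l).ncard ≤ j then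
    sideSign R ends ζ l x * sideSign R ends ζ l y else 0

/-! ## Implications -/

variable {R : Type*} [Ring R] [LinearOrder R]

/-- (DHK) ⟹ (DOWN): a down-set of hulls is a down-set of pairs through the first coordinate. -/
theorem sameDownRow_of_sameDHKRow (ends : E → Sym2 V) (l x y : V) (hd : SameDHKRow R ends l x y) :
    SameDownRow R ends l x y := by
  intro 𝒟 h𝒟
  have hlow : IsLowerSet {p : Set V × Set V | p.1 ∈ 𝒟} :=
    fun p q hqp hp => h𝒟 hqp.1 hp
  refine (hd _ hlow).trans (le_of_eq (Finset.sum_congr rfl fun ζ _ => ?_))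
  by_cases hc : hull ends ζ l ∈ 𝒟 <;> simp [hc]

/-- (DHK) ⟹ (CDOWN): a down-set of cores is a down-set of pairs through the second coordinate. -/
theorem sameCoreDownRow_of_sameDHKRow (ends : E → Sym2 V) (l x y : V)
    (hd : SameDHKRow R ends l x y) : SameCoreDownRow R ends l x y := by
  intro 𝒟 h𝒟
  have hlow : IsLowerSet {p : Set V × Set V | p.2 ∈ 𝒟} :=
    fun p q hqp hp => h𝒟 hqp.2 hp
  refine (hd _ hlow).trans (le_of_eq (Finset.sum_congr rfl fun ζ _ => ?_))
  by_cases hc : core ends ζ l ∈ 𝒟 <;> simp [hc]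

/-- (CDOWN) ⟹ (CS): `{K : |K| ≤ j}` is a down-set of (finite) vertex sets. -/
theorem sameCSRow_of_sameCoreDownRow [Fintype V] (ends : E → Sym2 V) (l x y : V)
    (hd : SameCoreDownRow R ends l x y) : SameCSRow R ends l x y := by
  intro j
  have hlow : IsLowerSet {K : Set V | K.ncard ≤ j} :=
    fun K K' hle hK => (Set.ncard_le_ncard hle (Set.toFinite K)).trans hK
  refine (hd _ hlow).trans (le_of_eq (Finset.sum_congr rfl fun ζ _ => ?_))
  by_cases hc : (core ends ζ l).ncard ≤ j <;> simp [hc]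

/-- **(DOWN) ⟹ the statement of record**: the avoidance sums `A(T;T)` are the principal down-sets
`{H : T ∩ H = ∅}`. -/
theorem avoidSameSideNonneg_of_sameDownRow (ends : E → Sym2 V)
    (hd : ∀ l x y : V, SameDownRow ℤ ends l x y) : AvoidSameSideNonneg ends := by
  intro l x y T
  have hlow : IsLowerSet {H : Set V | Disjoint T H} :=
    fun H H' hle hH => Disjoint.mono_right hle hH
  have h := hd l x y _ hlow
  unfold avoidSameSide
  refine h.trans (le_of_eq (Finset.sum_congr rfl fun ζ _ => ?_))
  by_cases hc : Disjoint T (hull ends ζ l) <;> simp [hc, avoid_self_iff]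

/-- **The `j = 1` layer of (CS) is the core-trivial theorem**: `Σ_{|core| ≤ 1} s_{x,l} s_{y,l} ≥ 0`. -/
theorem sameCS_one [Fintype V] {R : Type*} [Field R] [LinearOrder R] [IsStrictOrderedRing R]
    (ends : E → Sym2 V) (l x y : V) :
    0 ≤ ∑ ζ : Config E, if (core ends ζ l).ncard ≤ 1 then
      sideSign R ends ζ l x * sideSign R ends ζ l y else 0 := by
  refine (sum_sideSign_sideSign_nonneg_core (R := R) ends l x y).trans
    (le_of_eq (Finset.sum_congr rfl fun ζ _ => ?_))
  by_cases hK : core ends ζ l = {l}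
  · simp [hK]
  · have h1 : ¬ (core ends ζ l).ncard ≤ 1 := fun h => hK ((core_ncard_le_one_iff ends ζ l).1 h)
    simp [hK, h1]

/-- The core-trivial part of every (DOWN) down-set sum is nonnegative (restated from
`hullFamily_core_nonneg`): `Σ_{ζ : H_l ∈ 𝒟, core = {l}} s_{x,l} s_{y,l} ≥ 0`. -/
theorem sameDown_coreTrivial_nonneg (ends : E → Sym2 V) (l x y : V) (𝒟 : Set (Set V)) :
    0 ≤ ∑ ζ : Config E, if hull ends ζ l ∈ 𝒟 ∧ core ends ζ l = {l} then
      sideSign ℤ ends ζ l x * sideSign ℤ ends ζ l y else 0 :=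
  hullFamily_core_nonneg ends l x y 𝒟

end Hull

end Summit.Ventures.PercRepro2
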